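import Summits.CriticalPhenomena.PercolationContinuityZ3.Theorems.Transplant.CayleyMilnorKernel
import HarnessLib

/-!
# `b₁(Γ) ≥ 2 ⟹ p_c(Cay(Γ; S)) < 1` for EVERY finite generating set — from the rank-2 homomorphism ALONE (no kernel, growth or node hypothesis)

builds on p205010 (kernel theorem, internal audit signed; external expert review pending) — nothing in this file uses p205010; unconditional, no node.
Lane `prim-bschramm`, seat `prim-bschramm-p4` gen 21 (PART C3 of `P4-GENERAL.md` §43).  Helper file (`--supports stmt-CriticalPhenomena-4575 --as helper`).

`CayleyScaled` (gen 16) packages a rank-2 additive chart TOGETHER with a finite kernel generating set (needed for (κ′)); the weak-covering bound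
`p_c ≤ ½ < 1` (`Skelφ.criticalProb_lt_one_of_steps`, Benjamini–Schramm Thm 1) needs only the EXACT `N`-steps of the max-area re-based chart,
i.e. only the chart.  This file extracts that: **`CayleyRank.criticalProb_lt_one_of_rank`** — an additive `φ : Γ → ℤ²` of rank-2 image and any
finite generating `S` give `p_c(Cay(Γ;S), g) < 1` at every vertex; two-character form `criticalProb_lt_one_of_two_characters`.  Together with
`Nilpotent.exists_two_characters_of_criticalProb_lt_one` (file `CayleyNilpotentBSConj`) this closes the kernel DICHOTOMY for finitely generated
nilpotent groups: `p_c(Cay(Γ;S)) < 1 ⟺ b₁(Γ) ≥ 2`.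
* `exists_rank_pair_mem` (an independent pair among the GENERATOR images), `coarseSteps`, **`criticalProb_lt_one_of_rank`**,
  `criticalProb_lt_one_of_two_characters`.
[cite: BenjaminiSchramm1996, Thm. 1; Conj. 4; §2 (Cayley graphs)]
-/

noncomputable section

namespace Summit.CriticalPhenomena.PercolationContinuityZ3.Theorems.Transplant

open SimpleGraph Literature.Probability.LatticeModels Literature.Probability.Percolation
open Literature.Barriers.CriticalPhenomena (countable_of_connected_of_locallyFinite)
open scoped Classical

namespace CayleyRank

variable {Γ : Type} [Group Γ]

/-- **An independent pair among the generator images**: if `S` generates and the additive `φ` has two independent images anywhere, it has two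
independent images on `S` (otherwise every image is parallel to one generator image). [folklore] -/
theorem exists_rank_pair_mem (φ : Γ → Site 2) (map_mul : ∀ g h : Γ, φ (g * h) = φ g + φ h) {S : Finset Γ}
    (gen : Subgroup.closure (S : Set Γ) = ⊤) (rank : ∃ g h : Γ, MaxArea.det2 (φ g) (φ h) ≠ 0) :
    ∃ u ∈ S.image φ, ∃ v ∈ S.image φ, MaxArea.det2 u v ≠ 0 := by
  by_contra hno
  push Not at hno
  have hno' : ∀ s ∈ S, ∀ s' ∈ S, MaxArea.det2 (φ s) (φ s') = 0 := fun s hs s' hs' =>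
    hno _ (Finset.mem_image_of_mem φ hs) _ (Finset.mem_image_of_mem φ hs')
  obtain ⟨g, h, hgh⟩ := rank
  have φ_one : φ 1 = 0 := by have e := map_mul 1 1; rw [one_mul] at e; exact left_eq_add.1 e
  have φ_inv : ∀ x, φ x⁻¹ = -φ x := fun x => by
    have e := map_mul x⁻¹ x; rw [inv_mul_cancel, φ_one] at e; exact eq_neg_of_add_eq_zero_left e.symm
  have par : ∀ w : Site 2, (∀ s ∈ S, MaxArea.det2 (φ s) w = 0) → ∀ x : Γ, MaxArea.det2 (φ x) w = 0 := by
    intro w hw x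
    have hx : x ∈ Subgroup.closure (S : Set Γ) := by rw [gen]; exact Subgroup.mem_top x
    induction hx using Subgroup.closure_induction with
    | mem y hy => exact hw y (Finset.mem_coe.1 hy)
    | one => rw [φ_one, MaxArea.det2_zero_left]
    | mul y z _ _ hy hz => rw [map_mul, MaxArea.det2_add_left, hy, hz, add_zero]
    | inv y _ hy => rw [φ_inv, MaxArea.det2_neg_left, hy, neg_zero]
  by_cases hall : ∀ s ∈ S, φ s = 0
  · have h0 : ∀ x : Γ, φ x = 0 := by
      intro x
      have hx : x ∈ Subgroup.closure (S : Set Γ) := by rw [gen]; exact Subgroup.mem_top x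
      induction hx using Subgroup.closure_induction with
      | mem y hy => exact hall y (Finset.mem_coe.1 hy)
      | one => exact φ_one
      | mul y z _ _ hy hz => rw [map_mul, hy, hz, add_zero]
      | inv y _ hy => rw [φ_inv, hy, neg_zero]
    exact hgh (by rw [h0 g, MaxArea.det2_zero_left])
  · push Not at hall
    obtain ⟨s₀, hs₀, hw⟩ := hall
    have hpar : ∀ x : Γ, MaxArea.det2 (φ x) (φ s₀) = 0 := par (φ s₀) (fun s hs => hno' s hs s₀ hs₀)
    exact hgh (CayleyScaled.det2_eq_zero_of_parallel hw (hpar g) (hpar h))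

/-- **Unit steps of the coarse re-based chart** along single `S`-edges: with the max-area pair `(u,v)` among the generator images,
`ψ = rebase u v ∘ φ` has `ψ(t₀) = N e₀`, `ψ(t₁) = N e₁` for generators `t₀, t₁ ∈ S`, so `g ↦ ⌊ψ g / N⌋` has exact unit steps. [folklore] -/
theorem coarseSteps (φ : Γ → Site 2) (map_mul : ∀ g h : Γ, φ (g * h) = φ g + φ h) {S : Finset Γ}
    (gen : Subgroup.closure (S : Set Γ) = ⊤) (rank : ∃ g h : Γ, MaxArea.det2 (φ g) (φ h) ≠ 0) :
    ∃ χ : Γ → Site 2, Skelφ.Steps (mulCayley (S : Set Γ)) χ := by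
  obtain ⟨u, hu, v, hv, hD, hru, hrv, -⟩ := MaxArea.exists_rebase (S.image φ) (exists_rank_pair_mem φ map_mul gen rank)
  obtain ⟨t₀, ht₀, hφ₀⟩ := Finset.mem_image.1 hu
  obtain ⟨t₁, ht₁, hφ₁⟩ := Finset.mem_image.1 hv
  set N : ℤ := |MaxArea.det2 u v| with hN
  have hN0 : N ≠ 0 := abs_ne_zero.2 hD
  let ψ : Γ → Site 2 := fun g => MaxArea.rebase u v (φ g)
  have ψ_mul : ∀ g h, ψ (g * h) = ψ g + ψ h := fun g h => by
    show MaxArea.rebase u v (φ (g * h)) = _; rw [map_mul, MaxArea.rebase_add]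
  have φ_one : φ 1 = 0 := by have e := map_mul 1 1; rw [one_mul] at e; exact left_eq_add.1 e
  have φ_inv : ∀ x, φ x⁻¹ = -φ x := fun x => by
    have e := map_mul x⁻¹ x; rw [inv_mul_cancel, φ_one] at e; exact eq_neg_of_add_eq_zero_left e.symm
  have ψ_inv : ∀ g, ψ g⁻¹ = -ψ g := fun g => by show MaxArea.rebase u v (φ g⁻¹) = _; rw [φ_inv, MaxArea.rebase_neg]
  -- the step generators
  let t : Fin 2 → Γ := fun i => if i = 0 then t₀ else t₁
  have ht : ∀ i, t i ∈ S := fun i => by fin_cases i <;> simp [t, ht₀, ht₁]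
  have hψt : ∀ i, ψ (t i) = Pi.single i N := fun i => by
    fin_cases i
    · show MaxArea.rebase u v (φ t₀) = _; rw [hφ₀, hru]; rfl
    · show MaxArea.rebase u v (φ t₁) = _; rw [hφ₁, hrv]; rfl
  have ht1 : ∀ i, t i ≠ 1 := fun i h1 => by
    have e := congrFun (hψt i) i
    have : ψ (t i) = 0 := by rw [h1]; show MaxArea.rebase u v (φ 1) = 0; rw [φ_one, MaxArea.rebase_zero]
    rw [this, Pi.zero_apply, Pi.single_eq_same] at e
    exact hN0 e.symm
  refine ⟨fun g i => ψ g i / N, fun g i σ => ?_⟩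
  rcases Int.units_eq_one_or σ with rfl | rfl
  · refine ⟨g * t i, CayCyl.adj_mul_of_mem S (Or.inl (ht i)) (ht1 i) g, funext fun j => ?_⟩
    show ψ (g * t i) j / N = ψ g j / N + (Pi.single i ((1 : ℤˣ) : ℤ) : Site 2) j
    rw [ψ_mul, hψt, Pi.add_apply]
    by_cases hj : j = i
    · subst hj
      rw [Pi.single_eq_same, Pi.single_eq_same, Units.val_one, show ψ g j + N = ψ g j + 1 * N by ring,
        Int.add_mul_ediv_right _ _ hN0]
    · rw [Pi.single_eq_of_ne hj, Pi.single_eq_of_ne hj, add_zero, add_zero]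
  · refine ⟨g * (t i)⁻¹, CayCyl.adj_mul_of_mem S (Or.inr (by rw [inv_inv]; exact ht i)) (inv_ne_one.2 (ht1 i)) g, funext fun j => ?_⟩
    show ψ (g * (t i)⁻¹) j / N = ψ g j / N + (Pi.single i ((-1 : ℤˣ) : ℤ) : Site 2) j
    rw [ψ_mul, ψ_inv, hψt, Pi.add_apply, Pi.neg_apply]
    by_cases hj : j = i
    · subst hj
      rw [Pi.single_eq_same, Pi.single_eq_same, Units.val_neg, Units.val_one, ← sub_eq_add_neg,
        show ψ g j - N = ψ g j + (-1) * N by ring, Int.add_mul_ediv_right _ _ hN0]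
    · rw [Pi.single_eq_of_ne hj, Pi.single_eq_of_ne hj, neg_zero, add_zero, add_zero]

/-- **THEOREM (unconditional): `b₁(Γ) ≥ 2 ⟹ p_c(Cay(Γ; S)) < 1`** — an additive `φ : Γ → ℤ²` with two independent images and ANY finite generating
`S` give `p_c < 1` at every vertex (weak covering of `ℤ²` by the coarse re-based chart; Benjamini–Schramm Thm 1 / Kesten).
[cite: BenjaminiSchramm1996, Thm. 1; §2 (Cayley graphs)] -/
theorem criticalProb_lt_one_of_rank (φ : Γ →* Multiplicative (Site 2))
    (hrank : ∃ a b : Γ, MaxArea.det2 (Multiplicative.toAdd (φ a)) (Multiplicative.toAdd (φ b)) ≠ 0)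
    (S : Finset Γ) (hS : Subgroup.closure (S : Set Γ) = ⊤) (g : Γ) : criticalProb (mulCayley (↑S : Set Γ)) g < 1 := by
  haveI : Countable Γ := countable_of_connected_of_locallyFinite _ (CayleyScaled.connected_mulCayley_of_closure S hS) 1
  obtain ⟨χ, hχ⟩ := coarseSteps (fun x => Multiplicative.toAdd (φ x)) (fun x y => by rw [map_mul, toAdd_mul]) hS hrank
  exact Skelφ.criticalProb_lt_one_of_steps hχ g

/-- **Two-character form**: independent characters `ψ₀, ψ₁ : Γ → ℤ` give `p_c(Cay(Γ;S)) < 1` for every finite generating `S`.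
[cite: BenjaminiSchramm1996, Thm. 1; §2 (Cayley graphs)] -/
theorem criticalProb_lt_one_of_two_characters (ψ₀ ψ₁ : Γ →* Multiplicative ℤ) (a b : Γ)
    (hind : Multiplicative.toAdd (ψ₀ a) * Multiplicative.toAdd (ψ₁ b) ≠ Multiplicative.toAdd (ψ₁ a) * Multiplicative.toAdd (ψ₀ b))
    (S : Finset Γ) (hS : Subgroup.closure (S : Set Γ) = ⊤) (g : Γ) : criticalProb (mulCayley (↑S : Set Γ)) g < 1 :=
  criticalProb_lt_one_of_rank (CayleyScaled.pairHom ψ₀ ψ₁)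
    ⟨a, b, by rw [MaxArea.det2, CayleyScaled.toAdd_pairHom_zero, CayleyScaled.toAdd_pairHom_one, CayleyScaled.toAdd_pairHom_zero,
      CayleyScaled.toAdd_pairHom_one]; exact sub_ne_zero.2 hind⟩ S hS g

end CayleyRank

end Summit.CriticalPhenomena.PercolationContinuityZ3.Theorems.Transplant

end
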